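import Mathlib.NumberTheory.Padics.ValuativeRel
import Literature.AlgebraicGeometry.Frobenioids.PadicFrobenioidZero
import Literature.AlgebraicGeometry.Frobenioids.ModelFrobenioidFunctor
import Literature.AlgebraicGeometry.Frobenioids.PerfFactorial
import Literature.AlgebraicGeometry.Frobenioids.Categories
import Literature.AlgebraicGeometry.Frobenioids.CategoriesFactorization
import HarnessLib

/-!
# Frobenioids II, Example 1.1 (ii): `p`-adic Frobenioids

Mochizuki, *The geometry of Frobenioids II*, Kyushu J. Math. **62** (2008) 401–460, §1 Example 1.1 (ii),
author's text pp. 8–9 [cite: MochizukiFrdII2008, Ex 1.1 (ii) pp.8-9]: over "a connected, totally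
epimorphic category `D`" with "a functor `D → D₀`", a "monoprime subfunctor in monoids
`Φ ⊆ Φ₀^Λ|_D`" such that `B := B₀^Λ|_D ×_{(Φ₀^Λ)^gp|_D} Φ^gp → Φ^gp` has nonzero images; "We shall refer to
as a *`p`-adic Frobenioid* the Frobenioid `C` that arises as the model Frobenioid associated to this data
`Φ`, `B → Φ^gp`"; and the conditions *absolutely primitive* / *fieldwise saturated*.

**Functorial typing (answering the review of the first version).** The base data are not free: a
`Datum` carries a base functor `base : D ⥤ PadicFld p` (the printed `D → D₀`; `PadicFld p` and the
functors `phiZero = Spec K ↦ ord(O_K^⊳) ⊗ ℝ_{≥0}`, `bZero = Spec K ↦ K^×`, `divZero : B₀ → Φ₀^gp` with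
their functor laws / naturality are CONSTRUCTED in `PadicFrobenioidZero.lean`), and
`Φ₀|_D := base.op ⋙ phiZero`, `B₀|_D := base.op ⋙ bZero`, `div₀ := divZero` whiskered are DEFINITIONS,
so all restriction maps are the arithmetic ones. The remaining fields are exactly the printed choices:
the subfunctor `Φ ↪ Φ₀|_D` (objectwise injective, monoprime) and the fibre product `B` with its two
projections (the square commutes and is cartesian objectwise), plus "nonzero". MONOID TYPE: this file
types `Λ = ℤ` (`B₀ = K^×`); the variants `C^ℚ := C^pf`, `C^ℝ := C^rlf` of p. 7–8 are the perfection /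
realification of `C` ([FrdI] Prop. 5.3, 5.5; abc-iut-L1-t2's files) and are not re-typed here.
The `p`-adic Frobenioid is the honest category `Datum.frobenioid := ModelFrobenioid Φ B divB` with its
structure functor to `F_Φ` (abc-iut-L1-t2's `ModelFrobenioid.toElem`, [FrdI] Thm. 5.2 (i), last sentence). Theorem 1.2 and
Remarks 1.2.1–1.2.2 are typed in `PadicFrobenioidThm12.lean`.
-/

namespace Literature.AlgebraicGeometry.Frobenioids

open CategoryTheory Opposite Function

universe v u

namespace PadicFrd

/-- "[i.e., `K` is a finite extension of `ℚ_p`]" (FrdII Ex. 1.1 (i), p. 7): the object `Spec K` of the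
base is a `p`-ADIC LOCAL FIELD — `K` admits a `ℚ_p`-algebra structure for which it is finite and along
which its valuative relation restricts to the `p`-adic one (so it is THE extension of the `p`-adic
valuation). This is the standing hypothesis under which Theorem 1.2 (i) (unit-profinite) and (iv)
(slimness, via [FrdI] Prop. 1.13 (iii)(b)) are printed; `PadicFld p` alone also admits e.g. `ℂ_p`.
[cite: MochizukiFrdII2008, Ex 1.1 (i) p.7] -/
@[mk_iff] structure PadicFld.IsPadicLocal {p : ℕ} [Fact p.Prime] (X : PadicFld.{u} p) : Prop where
  /-- a finite `ℚ_p`-algebra structure compatible with the valuative relations exists -/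
  exists_finite : ∃ _ : Algebra ℚ_[p] X.K, Module.Finite ℚ_[p] X.K ∧
    ∀ a b : ℚ_[p], algebraMap ℚ_[p] X.K a ≤ᵥ algebraMap ℚ_[p] X.K b ↔ a ≤ᵥ b

variable {D : Type u} [Category.{v} D] {p : ℕ} [Fact p.Prime]

/-! ### Example 1.1 (ii): the data over a base functor `D → D₀` -/

/-- `Φ₀^Λ|_D` for `Λ = ℤ`: the restriction of `Φ₀ = Spec K ↦ ord(O_K^⊳) ⊗ ℝ_{≥0}` along the base functor
`D → D₀` (FrdII Ex. 1.1 (ii), p. 8). [cite: MochizukiFrdII2008, Ex 1.1 (ii) p.8] -/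
noncomputable abbrev phiZeroOn (base : D ⥤ PadicFld.{u} p) : Dᵒᵖ ⥤ CommMonCat.{u} := base.op ⋙ phiZero p

/-- `B₀^Λ|_D` for `Λ = ℤ`: the restriction of `B₀ = Spec K ↦ K^×` along `D → D₀` (FrdII Ex. 1.1 (ii), p. 8).
[cite: MochizukiFrdII2008, Ex 1.1 (ii) p.8] -/
noncomputable abbrev bZeroOn (base : D ⥤ PadicFld.{u} p) : Dᵒᵖ ⥤ CommMonCat.{u} := base.op ⋙ bZero p

/-- `B₀|_D → (Φ₀|_D)^gp`, the restriction of `divZero` along `D → D₀`. [cite: MochizukiFrdII2008, Ex 1.1 (ii) p.8] -/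
noncomputable def divZeroOn (base : D ⥤ PadicFld.{u} p) : bZeroOn base ⟶ monoidGp (phiZeroOn base) :=
  Functor.whiskerLeft base.op (divZero p)

variable (D p) in
/-- **Example 1.1 (ii)** (FrdII p. 8), the data of a `p`-adic Frobenioid with `Λ = ℤ` over a connected,
totally epimorphic base: the base functor `D → D₀` (landing in finite extensions of `ℚ_p` with their
`p`-adic valuations: `isPadicLocal`) and the printed CHOICES — "a monoprime subfunctor
in monoids `Φ ⊆ Φ₀|_D`" (`Φ`, `ι`, `ι_injective`, `isMonoprime`) and the fibre product
"`B := B₀|_D ×_{Φ₀^gp|_D} Φ^gp → Φ^gp`" (`B`, `toB0`, `divB`, the commuting `square`, objectwise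
`cartesian`) such that "for every `A ∈ Ob(D)`, the homomorphism `B(A) → Φ^gp(A)` is nonzero"
(`nonzero`). The monoids `Φ₀|_D`, `B₀|_D` and `B₀|_D → Φ₀^gp|_D` are DEFINED from `base`
(`phiZeroOn`, `bZeroOn`, `divZeroOn`). [cite: MochizukiFrdII2008, Ex 1.1 (ii) p.8] -/
structure Datum : Type (max u v (u + 1)) where
  /-- the functor `D → D₀` to the base category of `p`-adic valued fields -/
  base : D ⥤ PadicFld.{u} p
  /-- every `Spec K` in the image is a finite extension of `ℚ_p` with its `p`-adic valuation (p. 7) -/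
  isPadicLocal : ∀ A : D, (base.obj A).IsPadicLocal
  /-- `D` is connected -/
  isConnected_base : IsConnected D
  /-- `D` is totally epimorphic -/
  isTotallyEpimorphic_base : IsTotallyEpimorphic D
  /-- the subfunctor `Φ ⊆ Φ₀|_D` -/
  Φ : Dᵒᵖ ⥤ CommMonCat.{u}
  /-- the inclusion `Φ ↪ Φ₀|_D` -/
  ι : Φ ⟶ phiZeroOn base
  /-- `ι` is objectwise injective ("subfunctor") -/
  ι_injective : ∀ A, Injective (ι.app A).hom
  /-- "monoprime … subfunctor in monoids": each `Φ(A)` is monoprime -/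
  isMonoprime : ∀ A, IsMonoprime (Φ.obj A)
  /-- the monoid `B` -/
  B : Dᵒᵖ ⥤ CommMonCat.{u}
  /-- the first projection `B → B₀|_D` -/
  toB0 : B ⟶ bZeroOn base
  /-- "`B → Φ^gp`", the second projection -/
  divB : B ⟶ monoidGp Φ
  /-- the fibre-product square commutes: `B → B₀ → Φ₀^gp` equals `B → Φ^gp → Φ₀^gp` -/
  square : toB0 ≫ divZeroOn base = divB ≫ Functor.whiskerRight ι MonGp.functor
  /-- the square is cartesian objectwise: `B(A) = B₀(A) ×_{Φ₀^gp(A)} Φ^gp(A)` -/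
  cartesian : ∀ A, Bijective fun b : B.obj A =>
    (⟨((toB0.app A).hom b, (divB.app A).hom b),
        congrArg (fun f : B ⟶ monoidGp (phiZeroOn base) => (f.app A).hom b) square⟩ :
      {q : (bZeroOn base).obj A × Algebra.GrothendieckGroup (Φ.obj A) //
        ((divZeroOn base).app A).hom q.1 = ((Functor.whiskerRight ι MonGp.functor).app A).hom q.2})
  /-- "for every `A ∈ Ob(D)`, the homomorphism `B(A) → Φ^gp(A)` is nonzero" -/
  nonzero : ∀ A, ∃ b : B.obj A, (divB.app A).hom b ≠ 1

namespace Datum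

variable (d : Datum D p)

/-- The field `K_A` over which `A ∈ Ob(D)` lies (the image of `A` in `D₀`). [cite: MochizukiFrdII2008, Ex 1.1 (ii) p.8] -/
abbrev fld (A : D) : Type u := (d.base.obj A).K

/-- **Example 1.1 (ii)** (FrdII p. 8): "We shall refer to as a *`p`-adic Frobenioid* the Frobenioid `C`
that arises as the model Frobenioid associated to this data `Φ`, `B → Φ^gp` [cf. [FrdI], Theorem 5.2,
(ii)]." [cite: MochizukiFrdII2008, Ex 1.1 (ii) p.8] -/
abbrev frobenioid : Type u := ModelFrobenioid d.Φ d.B d.divB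

/-- The pre-Frobenioid structure `C → F_Φ` of the `p`-adic Frobenioid. [cite: MochizukiFrdII2008, Ex 1.1 (ii) p.8] -/
abbrev structureFunctor : d.frobenioid ⥤ ElemFrobenioid d.Φ := ModelFrobenioid.toElem d.Φ d.B d.divB

/-- The composite projection `C → D → D₀` (an object `A` goes to `A₀ := ` the image of `A_D` in `D₀`,
as in Theorem 1.2 (ii)). [cite: MochizukiFrdII2008, Thm 1.2 (ii) p.9] -/
noncomputable abbrev toBaseZero : d.frobenioid ⥤ PadicFld.{u} p :=
  ModelFrobenioid.baseFunctor d.Φ d.B d.divB ⋙ d.base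

/-- `ord(O_{K_A}^⊳) → Φ₀(A)^gp`: class ↦ its image in `(ord(O_K^⊳) ⊗ ℝ_{≥0})^gp`.
[cite: MochizukiFrdII2008, Ex 1.1 (i) p.7] -/
noncomputable def ordIntGp (A : D) :
    OrdInt (d.fld A) →* Algebra.GrothendieckGroup (Realification (OrdInt (d.fld A))) :=
  Algebra.GrothendieckGroup.of.comp (Realification.of (OrdInt (d.fld A)))

/-- `ord(K_A^×) ⊆ Φ₀(A)^gp`: the subgroup generated by `ord(O_{K_A}^⊳)` (= `ord(O_K^⊳)^gp`,
`PadicValueGroupification.gpEquivOrdUnits`). [cite: MochizukiFrdII2008, Ex 1.1 (ii) pp.8-9] -/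
noncomputable def ordUnitsSubgroup (A : D) :
    Subgroup (Algebra.GrothendieckGroup (Realification (OrdInt (d.fld A)))) :=
  Subgroup.closure (Set.range (d.ordIntGp A))

/-- `ord(ℚ_p^×) ⊆ Φ₀(A)^gp`: the cyclic subgroup generated by `ord(p)`.
[cite: MochizukiFrdII2008, Ex 1.1 (ii) p.8] -/
noncomputable def ordQpSubgroup (A : D) :
    Subgroup (Algebra.GrothendieckGroup (Realification (OrdInt (d.fld A)))) :=
  Subgroup.zpowers (d.ordIntGp A (Associates.mk ⟨((p : ℕ) : d.fld A), (d.base.obj A).p_mem⟩))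

/-- `Φ(A) → Φ₀(A)^gp`, the inclusion followed by groupification. [cite: MochizukiFrdII2008, Ex 1.1 (ii) p.8] -/
noncomputable def phiGp (A : D) :
    d.Φ.obj (op A) →* Algebra.GrothendieckGroup (Realification (OrdInt (d.fld A))) :=
  Algebra.GrothendieckGroup.of.comp (d.ι.app (op A)).hom

/-- `Λ · H` for a subgroup `H` of a commutative group (FrdII Ex. 1.1 (ii), p. 8: "`Λ · ord(ℚ_p^×)`"):
`Λ = ℤ` the subgroup, `Λ = ℚ` its divisible hull, `Λ = ℝ` everything (`Φ₀^gp ≅ ℝ`).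
[cite: MochizukiFrdII2008, Ex 1.1 (ii) p.8] -/
def lambdaSpan {G : Type u} [CommGroup G] (Λ : MonoidType) (H : Subgroup G) : Set G :=
  match Λ with
  | .Z => H
  | .Q => {x | ∃ n : ℕ, 0 < n ∧ x ^ n ∈ H}
  | .R => Set.univ

/-- **Example 1.1 (ii)** (FrdII pp. 8–9): `Φ` is *absolutely primitive* if
"`Φ(K) ⊆ Λ · ord(ℚ_p^×) (⊆ ord(K^×) ⊗_ℤ ℝ = (ord(O_K^⊳)^rlf)^gp)` for every `Spec K`"; here `Λ = ℤ`.
[cite: MochizukiFrdII2008, Ex 1.1 (ii) pp.8-9] -/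
def IsAbsolutelyPrimitive : Prop :=
  ∀ (A : D) (x : d.Φ.obj (op A)), d.phiGp A x ∈ lambdaSpan .Z (d.ordQpSubgroup A)

/-- **Example 1.1 (ii)** (FrdII pp. 8–9): `Φ` is *fieldwise saturated* if
"`ord(K^×) ⊆ Φ(K) (⊆ ord(K^×) ⊗_ℤ ℝ)` for every `Spec K`" — read as an inclusion of `ord(K^×)` in the
group generated by `Φ(K)` inside `Φ₀(K)^gp` (equivalently `ord(O_K^⊳) ⊆ Φ(K)`, as `Φ(K)` is monoprime).
[cite: MochizukiFrdII2008, Ex 1.1 (ii) pp.8-9] -/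
def IsFieldwiseSaturated : Prop :=
  ∀ A : D, d.ordUnitsSubgroup A ≤ Subgroup.closure (Set.range (d.phiGp A))

end Datum

/-! ### Example 1.1 (i) as an instance: `Φ := Φ₀`, `B := B₀` over the identity base -/

/-- `M ⊗ ℝ_{≥0}` (functions into `ℝ_{≥0}`) is cancellative — pointwise cancellation in `ℝ_{≥0}`
([FrdI] §0 p. 10: `M ⊗ ℝ_{≥0}` is `ℝ`-monoprime, in particular integral).
[cite: MochizukiFrdI2008, §0 p.10] -/
theorem isCancelMul_realification (M : Type u) [CommMonoid M] : IsCancelMul (Realification M) where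
  mul_left_cancel F G H h := MonoidHom.ext fun g =>
    mul_left_cancel (a := (show RDual (RDual M) from F) g)
      (DFunLike.congr_fun (show (show RDual (RDual M) from F * G) = (show RDual (RDual M) from F * H)
        from h) g)
  mul_right_cancel F G H h := MonoidHom.ext fun g =>
    mul_right_cancel (b := (show RDual (RDual M) from F) g)
      (DFunLike.congr_fun (show (show RDual (RDual M) from G * F) = (show RDual (RDual M) from H * F)
        from h) g)


/-- The datum of the `p`-adic Frobenioid `C₀` itself over a base `D → D₀` (no further choices):
`Φ := Φ₀|_D` (monoprime since `ord(O_K^⊳)` is, realified), `B := B₀|_D`, the square being the trivial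
one (FrdII Ex. 1.1 (i): "this data determines a [model] Frobenioid `C₀`"). The two arithmetic inputs —
`ord(O_K^⊳)` monoprime for the fields in the image of `D`, and connectedness / total epimorphicity of
`D` — are the hypotheses, together with the standing "finite extension of `ℚ_p`" condition.
[cite: MochizukiFrdII2008, Ex 1.1 (i)(ii) pp.7-8] -/
noncomputable def Datum.zero (base : D ⥤ PadicFld.{u} p) (hloc : ∀ A : D, (base.obj A).IsPadicLocal)
    (hc : IsConnected D) (he : IsTotallyEpimorphic D)
    (hmono : ∀ A : D, IsMonoprime (OrdInt (base.obj A).K)) : Datum D p where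
  base := base
  isPadicLocal := hloc
  isConnected_base := hc
  isTotallyEpimorphic_base := he
  Φ := phiZeroOn base
  ι := 𝟙 _
  ι_injective A := fun x y h => h
  isMonoprime A := IsMonoprime.ofR (isRMonoprime_realification (hmono A.unop))
  B := bZeroOn base
  toB0 := 𝟙 _
  divB := divZeroOn base
  square := by
    rw [Category.id_comp, Functor.whiskerRight_id', Category.comp_id]
  cartesian A := by
    constructor
    · intro b b' h
      have := congrArg (fun q => q.1.1) h
      exact this
    · rintro ⟨⟨q1, q2⟩, hq⟩
      refine ⟨q1, Subtype.ext (Prod.ext rfl ?_)⟩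
      change ((divZeroOn base).app A).hom q1 = q2
      rw [hq]
      change MonGp.map (MonoidHom.id _) q2 = q2
      rw [MonGp.map_id]
      rfl
  nonzero A := by
    haveI := isCancelMul_realification (OrdInt (base.obj A.unop).K)
    refine ⟨intNonzeroToUnits _ ⟨((p : ℕ) : (base.obj A.unop).K), (base.obj A.unop).p_mem⟩, ?_⟩
    change divZeroHom (base.obj A.unop).K (intNonzeroToUnits _ _) ≠ 1
    rw [divZeroHom_intNonzeroToUnits]
    intro h
    -- `[p] ⊗ 1 = 1` in `Φ₀^gp` forces `[p] = 1` in `ord(O_K^⊳)`, i.e. `p` a unit: contradicts `v(p) < 1`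
    have h' : Realification.of _ (Associates.mk (⟨((p : ℕ) : (base.obj A.unop).K), (base.obj A.unop).p_mem⟩ :
        intNonzero (base.obj A.unop).K)) = 1 :=
      Algebra.GrothendieckGroup.of_injective (h.trans (map_one _).symm)
    have h1 : Associates.mk (⟨((p : ℕ) : (base.obj A.unop).K), (base.obj A.unop).p_mem⟩ :
        intNonzero (base.obj A.unop).K) = 1 :=
      Realification.of_injective (hmono A.unop) (h'.trans (map_one _).symm)
    rw [Associates.mk_eq_one] at h1
    exact (base.obj A.unop).p_lt.ne ((isUnit_intNonzero_iff _ _).mp h1)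

end PadicFrd

end Literature.AlgebraicGeometry.Frobenioids
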